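import Literature.NumberTheory.NumberFields.CyclotomicFieldFourValuations
import Literature.NumberTheory.QuadraticFields.SqrtNegTwoPrimary
import Literature.NumberTheory.QuadraticFields.SqrtNegTwoFieldPrimes
import Mathlib.Tactic.NormNum.Prime
import HarnessLib

/-!
# The `ℚ(√−2)` valuation table of the `5`-descent of `E_{−37/152}` over `ℚ(√−2)`: four places (one INERT), five Kummer values

PROOF-ONLY file (theorems only, no definition, no named fact, no `sorry`), topic `NumberTheory/EllipticCurves`; the arithmetic input
of the instance `KubertTateM37152SqrtNegTwoDescent` (second complete `5`-descent over `ℚ(√−2)`, after `KubertTate1718SqrtNegTwo*`).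
Carrier: any number field `K` with `[K : ℚ] = 2`, `θ ∈ K`, `θ² = −2` (tree `SqrtNegTwo.FieldData θ`; `hK.ringEquiv ⟨a, b⟩ = a + bθ`).

`E = E_{−37/152} = [189, 5624, 854848, 0, 0]` (`kubertTateFive (−37) 152`; rank `2`, `t₅ = 0` over `ℚ`, tree `KubertTateM37152ShaFive`),
`mn = −5624 = −2³·19·37`: `19 ≡ 3 (mod 8)` SPLITS in `ℤ[√−2]` (`19 = (1 + 3θ)(1 − 3θ)`), `37 ≡ 5 (mod 8)` is INERT (prime in `ℤ[√−2]`,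
tree `SqrtNegTwoPrimary.prime_natCast_of_mod_eight`), `2 = −θ²` ramifies: FOUR places `v₀ = (θ)`, `v₁ = (1 + 3θ)`, `v₂ = (1 − 3θ)`,
`v₃ = (37)` (`exists_places`).  The five Kummer values `f_T = xy − 152x² + 23104y` are those of the `ℚ`-points `−T = (0, −854848)`,
`P₁ = (−830, 4700)`, `P₂ = (−2964, 64980)` (`−19750408192`, `−25000`, `−26667792`), of the `K`-point
`R₁ = (−13376, 836608 + 586112θ)` (`−19056918528 + 5701697536θ`) — the `K`-point attached to the rational point `u = −13376` of the twist
`−2Y² = g(u)` — and of the base point `2T = (−5624, 208088)` (`−1170286912`).  Their orders: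

  `ord = [[24, 4, 4, 1], [6, 0, 0, 0], [8, 3, 3, 0], [30, 2, 3, 0]]`, base `[12, 2, 2, 3]` (`log v = -ord`),

each certified by an explicit factorisation in `ℤ[√−2]` (`decide`), the cofactor being a non-multiple of `π` (`y = πz + d`, `ℓ ∤ d`) resp.,
at the inert place, having a coordinate prime to `37`.  The `K`-row differs at the conjugate places `v₁ ≠ v₂`.  Instrument for
stmt-BirchSwinnertonDyer-22356 («T»); BSD is not proved by this.

## References

* [SilvermanAEC2009] J. H. Silverman, *AEC*, 2nd ed., Exercise 10.1(c), Thm. X.1.1.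
* [IrelandRosen1990] K. Ireland, M. Rosen, *A Classical Introduction to Modern Number Theory*, 2nd ed., Ch. 13 §1.
-/

noncomputable section

open scoped NumberField
open NumberField Ideal IsDedekindDomain Literature.NumberTheory.NumberFields Literature.NumberTheory.QuadraticFields

namespace Literature.NumberTheory.EllipticCurves

namespace KubertTateM37152SqrtNegTwoDescent

variable {K : Type} [Field K] [NumberField K] {θ : K}

/-! ## §1 The four places of `K` above `mn = −2³·19·37` -/

/-- An element of `ℤ[√−2]` of prime norm gives a prime element of `𝓞 K`. [cite: IrelandRosen1990, Ch. 13 §1] -/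
private theorem prime_ringEquiv (hK : SqrtNegTwo.FieldData θ) {z : ℤ√(-2)} {p : ℕ} (hp : p.Prime) (hz : z.norm = p) :
    Prime (hK.ringEquiv z) :=
  (MulEquiv.prime_iff hK.ringEquiv.toMulEquiv).mpr (SqrtNegTwoPrimary.prime_of_norm_eq_prime hp hz)

/-- **`37 ≡ 5 (mod 8)` is inert**: `37` is a prime element of `𝓞 K = ℤ[√−2]` (tree `SqrtNegTwoPrimary.prime_natCast_of_mod_eight`).
[cite: IrelandRosen1990, Ch. 13 §1 Prop. 13.1.3] -/
theorem prime_thirtyseven (hK : SqrtNegTwo.FieldData θ) : Prime ((37 : ℕ) : 𝓞 K) := by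
  haveI : Fact (Nat.Prime 37) := ⟨by norm_num⟩
  have h := SqrtNegTwoPrimary.prime_natCast_of_mod_eight (p := 37) (Or.inl (by norm_num))
  rw [← hK.ringEquiv_natCast]
  exact (MulEquiv.prime_iff hK.ringEquiv.toMulEquiv).mpr h

/-- **The places `(θ)`, `(1 + 3θ)`, `(1 − 3θ)`, `(37)` of `K = ℚ(√−2)`** (prime elements of norms `2, 19, 19, 37²`).
[cite: IrelandRosen1990, Ch. 13 §1] -/
theorem exists_places (hK : SqrtNegTwo.FieldData θ) :
    ∃ v₀ v₁ v₂ v₃ : HeightOneSpectrum (𝓞 K),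
      v₀.asIdeal = span {hK.ringEquiv ⟨0, 1⟩} ∧ v₁.asIdeal = span {hK.ringEquiv ⟨1, 3⟩} ∧
      v₂.asIdeal = span {hK.ringEquiv ⟨1, -3⟩} ∧ v₃.asIdeal = span {((37 : ℕ) : 𝓞 K)} := by
  obtain ⟨v₀, h₀⟩ := exists_asIdeal_eq_span (prime_ringEquiv hK (p := 2) (by norm_num) (by decide) : Prime (hK.ringEquiv ⟨0, 1⟩))
  obtain ⟨v₁, h₁⟩ := exists_asIdeal_eq_span (prime_ringEquiv hK (p := 19) (by norm_num) (by decide) : Prime (hK.ringEquiv ⟨1, 3⟩))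
  obtain ⟨v₂, h₂⟩ := exists_asIdeal_eq_span (prime_ringEquiv hK (p := 19) (by norm_num) (by decide) : Prime (hK.ringEquiv ⟨1, -3⟩))
  obtain ⟨v₃, h₃⟩ := exists_asIdeal_eq_span (prime_thirtyseven hK)
  exact ⟨v₀, v₁, v₂, v₃, h₀, h₁, h₂, h₃⟩

/-- The generators are prime elements of `𝓞 K`. [cite: IrelandRosen1990, Ch. 13 §1] -/
theorem prime_gens (hK : SqrtNegTwo.FieldData θ) :
    Prime (hK.ringEquiv ⟨0, 1⟩) ∧ Prime (hK.ringEquiv ⟨1, 3⟩) ∧ Prime (hK.ringEquiv ⟨1, -3⟩) ∧ Prime ((37 : ℕ) : 𝓞 K) :=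
  ⟨prime_ringEquiv hK (p := 2) (by norm_num) (by decide), prime_ringEquiv hK (p := 19) (by norm_num) (by decide),
    prime_ringEquiv hK (p := 19) (by norm_num) (by decide), prime_thirtyseven hK⟩

/-! ## §2 The valuation table -/

section Table

variable (hK : SqrtNegTwo.FieldData θ) {v₀ v₁ v₂ v₃ : HeightOneSpectrum (𝓞 K)}
  (hv₀ : v₀.asIdeal = span {hK.ringEquiv ⟨0, 1⟩}) (hv₁ : v₁.asIdeal = span {hK.ringEquiv ⟨1, 3⟩})
  (hv₂ : v₂.asIdeal = span {hK.ringEquiv ⟨1, -3⟩}) (hv₃ : v₃.asIdeal = span {((37 : ℕ) : 𝓞 K)})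

include hv₀ hv₁ hv₂ hv₃

/-- The rational primes `2, 19, 19, 37` lie in the four places (`2 = θ·(−θ)`, `19 = (1 + 3θ)(1 − 3θ)`).
[cite: IrelandRosen1990, Ch. 13 §1] -/
theorem natCast_mem_places :
    ((2 : ℕ) : 𝓞 K) ∈ v₀.asIdeal ∧ ((19 : ℕ) : 𝓞 K) ∈ v₁.asIdeal ∧ ((19 : ℕ) : 𝓞 K) ∈ v₂.asIdeal ∧ ((37 : ℕ) : 𝓞 K) ∈ v₃.asIdeal := by
  refine ⟨?_, ?_, ?_, ?_⟩
  · rw [hv₀, mem_span_singleton]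
    exact ⟨hK.ringEquiv ⟨0, -1⟩, by
      rw [← map_mul, show ((2 : ℕ) : 𝓞 K) = ((2 : ℤ) : 𝓞 K) by norm_cast, ← hK.ringEquiv_intCast]
      exact congrArg hK.ringEquiv (by decide)⟩
  · rw [hv₁, mem_span_singleton]
    exact ⟨hK.ringEquiv ⟨1, -3⟩, by
      rw [← map_mul, show ((19 : ℕ) : 𝓞 K) = ((19 : ℤ) : 𝓞 K) by norm_cast, ← hK.ringEquiv_intCast]
      exact congrArg hK.ringEquiv (by decide)⟩
  · rw [hv₂, mem_span_singleton]
    exact ⟨hK.ringEquiv ⟨1, 3⟩, by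
      rw [← map_mul, show ((19 : ℕ) : 𝓞 K) = ((19 : ℤ) : 𝓞 K) by norm_cast, ← hK.ringEquiv_intCast]
      exact congrArg hK.ringEquiv (by decide)⟩
  · rw [hv₃]; exact mem_span_singleton_self _


/-- **The orders of the four Kummer values at the four places**: rows `−T`, `P₁`, `P₂`, `R₁` (values `−19750408192`, `−25000`, `−26667792`,
`−19056918528 + 5701697536θ`); matrix `[[24, 4, 4, 1], [6, 0, 0, 0], [8, 3, 3, 0], [30, 2, 3, 0]]` (read as `log v = -ord`). [cite: SilvermanAEC2009, Exercise 10.1(c)] -/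
theorem log_valuation_points : ∀ i j : Fin 4,
    WithZero.log ((![v₀, v₁, v₂, v₃] j).valuation K
      ((![(hK.ringEquiv ⟨-19750408192, 0⟩ : 𝓞 K), (hK.ringEquiv ⟨-25000, 0⟩ : 𝓞 K), (hK.ringEquiv ⟨-26667792, 0⟩ : 𝓞 K), (hK.ringEquiv ⟨-19056918528, 5701697536⟩ : 𝓞 K)] i : 𝓞 K) : K)) =
      -((![![24, 4, 4, 1], ![6, 0, 0, 0], ![8, 3, 3, 0], ![30, 2, 3, 0]] : Fin 4 → Fin 4 → ℕ) i j : ℤ) := by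
  obtain ⟨hℓ₀, hℓ₁, hℓ₂, hℓ₃⟩ := natCast_mem_places hK hv₀ hv₁ hv₂ hv₃
  have hπ₀ : hK.ringEquiv ⟨0, 1⟩ ∈ v₀.asIdeal := by rw [hv₀]; exact mem_span_singleton_self _
  have hπ₁ : hK.ringEquiv ⟨1, 3⟩ ∈ v₁.asIdeal := by rw [hv₁]; exact mem_span_singleton_self _
  have hπ₂ : hK.ringEquiv ⟨1, -3⟩ ∈ v₂.asIdeal := by rw [hv₂]; exact mem_span_singleton_self _
  have e37 : ((37 : ℕ) : 𝓞 K) = hK.ringEquiv ⟨37, 0⟩ := by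
    rw [show ((37 : ℕ) : 𝓞 K) = ((37 : ℤ) : 𝓞 K) by norm_cast, ← hK.ringEquiv_intCast, Zsqrtd.intCast_val]

  have c00 : WithZero.log (v₀.valuation K ((hK.ringEquiv ⟨-19750408192, 0⟩ : 𝓞 K) : K)) = -24 := by
    rw [log_valuation_eq_neg_of_eq_pow_mul hv₀ 24 (y := hK.ringEquiv ⟨-4821877, 0⟩)
      (by rw [← map_pow, ← map_mul]; exact congrArg hK.ringEquiv (by decide))
      (not_mem_of_eq_mul_add_intCast (ℓ := 2) (by norm_num) hℓ₀ hπ₀ (z := hK.ringEquiv ⟨0, 2410939⟩) (d := 1)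
        (by rw [← map_mul, ← hK.ringEquiv_intCast, ← map_add]; exact congrArg hK.ringEquiv (by decide)) (by norm_num))]
    norm_num
  have c01 : WithZero.log (v₁.valuation K ((hK.ringEquiv ⟨-19750408192, 0⟩ : 𝓞 K) : K)) = -4 := by
    rw [log_valuation_eq_neg_of_eq_pow_mul hv₁ 4 (y := hK.ringEquiv ⟨-32886784, -30916608⟩)
      (by rw [← map_pow, ← map_mul]; exact congrArg hK.ringEquiv (by decide))
      (not_mem_of_eq_mul_add_intCast (ℓ := 19) (by norm_num) hℓ₁ hπ₁ (z := hK.ringEquiv ⟨-11494023, 3565461⟩) (d := 5)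
        (by rw [← map_mul, ← hK.ringEquiv_intCast, ← map_add]; exact congrArg hK.ringEquiv (by decide)) (by norm_num))]
    norm_num
  have c02 : WithZero.log (v₂.valuation K ((hK.ringEquiv ⟨-19750408192, 0⟩ : 𝓞 K) : K)) = -4 := by
    rw [log_valuation_eq_neg_of_eq_pow_mul hv₂ 4 (y := hK.ringEquiv ⟨-32886784, 30916608⟩)
      (by rw [← map_pow, ← map_mul]; exact congrArg hK.ringEquiv (by decide))
      (not_mem_of_eq_mul_add_intCast (ℓ := 19) (by norm_num) hℓ₂ hπ₂ (z := hK.ringEquiv ⟨-11494023, -3565461⟩) (d := 5)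
        (by rw [← map_mul, ← hK.ringEquiv_intCast, ← map_add]; exact congrArg hK.ringEquiv (by decide)) (by norm_num))]
    norm_num
  have c03 : WithZero.log (v₃.valuation K ((hK.ringEquiv ⟨-19750408192, 0⟩ : 𝓞 K) : K)) = -1 := by
    rw [log_valuation_eq_neg_of_eq_pow_mul hv₃ 1 (y := hK.ringEquiv ⟨-533794816, 0⟩)
      (by rw [e37, ← map_pow, ← map_mul]; exact congrArg hK.ringEquiv (by decide))
      (by
        rw [hv₃, mem_span_singleton, e37, map_dvd_iff hK.ringEquiv, ← Zsqrtd.intCast_val, Zsqrtd.intCast_dvd]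
        norm_num)]
    norm_num
  have c10 : WithZero.log (v₀.valuation K ((hK.ringEquiv ⟨-25000, 0⟩ : 𝓞 K) : K)) = -6 := by
    rw [log_valuation_eq_neg_of_eq_pow_mul hv₀ 6 (y := hK.ringEquiv ⟨3125, 0⟩)
      (by rw [← map_pow, ← map_mul]; exact congrArg hK.ringEquiv (by decide))
      (not_mem_of_eq_mul_add_intCast (ℓ := 2) (by norm_num) hℓ₀ hπ₀ (z := hK.ringEquiv ⟨0, -1562⟩) (d := 1)
        (by rw [← map_mul, ← hK.ringEquiv_intCast, ← map_add]; exact congrArg hK.ringEquiv (by decide)) (by norm_num))]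
    norm_num
  have c11 : WithZero.log (v₁.valuation K ((hK.ringEquiv ⟨-25000, 0⟩ : 𝓞 K) : K)) = -0 := by
    rw [log_valuation_eq_neg_of_eq_pow_mul hv₁ 0 (y := hK.ringEquiv ⟨-25000, 0⟩)
      (by rw [pow_zero, one_mul])
      (not_mem_of_eq_mul_add_intCast (ℓ := 19) (by norm_num) hℓ₁ hπ₁ (z := hK.ringEquiv ⟨-1316, 3948⟩) (d := 4)
        (by rw [← map_mul, ← hK.ringEquiv_intCast, ← map_add]; exact congrArg hK.ringEquiv (by decide)) (by norm_num))]
    norm_num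
  have c12 : WithZero.log (v₂.valuation K ((hK.ringEquiv ⟨-25000, 0⟩ : 𝓞 K) : K)) = -0 := by
    rw [log_valuation_eq_neg_of_eq_pow_mul hv₂ 0 (y := hK.ringEquiv ⟨-25000, 0⟩)
      (by rw [pow_zero, one_mul])
      (not_mem_of_eq_mul_add_intCast (ℓ := 19) (by norm_num) hℓ₂ hπ₂ (z := hK.ringEquiv ⟨-1316, -3948⟩) (d := 4)
        (by rw [← map_mul, ← hK.ringEquiv_intCast, ← map_add]; exact congrArg hK.ringEquiv (by decide)) (by norm_num))]
    norm_num
  have c13 : WithZero.log (v₃.valuation K ((hK.ringEquiv ⟨-25000, 0⟩ : 𝓞 K) : K)) = -0 := by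
    rw [log_valuation_eq_neg_of_eq_pow_mul hv₃ 0 (y := hK.ringEquiv ⟨-25000, 0⟩)
      (by rw [pow_zero, one_mul])
      (by
        rw [hv₃, mem_span_singleton, e37, map_dvd_iff hK.ringEquiv, ← Zsqrtd.intCast_val, Zsqrtd.intCast_dvd]
        norm_num)]
    norm_num
  have c20 : WithZero.log (v₀.valuation K ((hK.ringEquiv ⟨-26667792, 0⟩ : 𝓞 K) : K)) = -8 := by
    rw [log_valuation_eq_neg_of_eq_pow_mul hv₀ 8 (y := hK.ringEquiv ⟨-1666737, 0⟩)
      (by rw [← map_pow, ← map_mul]; exact congrArg hK.ringEquiv (by decide))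
      (not_mem_of_eq_mul_add_intCast (ℓ := 2) (by norm_num) hℓ₀ hπ₀ (z := hK.ringEquiv ⟨0, 833369⟩) (d := 1)
        (by rw [← map_mul, ← hK.ringEquiv_intCast, ← map_add]; exact congrArg hK.ringEquiv (by decide)) (by norm_num))]
    norm_num
  have c21 : WithZero.log (v₁.valuation K ((hK.ringEquiv ⟨-26667792, 0⟩ : 𝓞 K) : K)) = -3 := by
    rw [log_valuation_eq_neg_of_eq_pow_mul hv₁ 3 (y := hK.ringEquiv ⟨206064, -174960⟩)
      (by rw [← map_pow, ← map_mul]; exact congrArg hK.ringEquiv (by decide))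
      (not_mem_of_eq_mul_add_intCast (ℓ := 19) (by norm_num) hℓ₁ hπ₁ (z := hK.ringEquiv ⟨-44406, -41742⟩) (d := 18)
        (by rw [← map_mul, ← hK.ringEquiv_intCast, ← map_add]; exact congrArg hK.ringEquiv (by decide)) (by norm_num))]
    norm_num
  have c22 : WithZero.log (v₂.valuation K ((hK.ringEquiv ⟨-26667792, 0⟩ : 𝓞 K) : K)) = -3 := by
    rw [log_valuation_eq_neg_of_eq_pow_mul hv₂ 3 (y := hK.ringEquiv ⟨206064, 174960⟩)
      (by rw [← map_pow, ← map_mul]; exact congrArg hK.ringEquiv (by decide))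
      (not_mem_of_eq_mul_add_intCast (ℓ := 19) (by norm_num) hℓ₂ hπ₂ (z := hK.ringEquiv ⟨-44406, 41742⟩) (d := 18)
        (by rw [← map_mul, ← hK.ringEquiv_intCast, ← map_add]; exact congrArg hK.ringEquiv (by decide)) (by norm_num))]
    norm_num
  have c23 : WithZero.log (v₃.valuation K ((hK.ringEquiv ⟨-26667792, 0⟩ : 𝓞 K) : K)) = -0 := by
    rw [log_valuation_eq_neg_of_eq_pow_mul hv₃ 0 (y := hK.ringEquiv ⟨-26667792, 0⟩)
      (by rw [pow_zero, one_mul])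
      (by
        rw [hv₃, mem_span_singleton, e37, map_dvd_iff hK.ringEquiv, ← Zsqrtd.intCast_val, Zsqrtd.intCast_dvd]
        norm_num)]
    norm_num
  have c30 : WithZero.log (v₀.valuation K ((hK.ringEquiv ⟨-19056918528, 5701697536⟩ : 𝓞 K) : K)) = -30 := by
    rw [log_valuation_eq_neg_of_eq_pow_mul hv₀ 30 (y := hK.ringEquiv ⟨581571, -174002⟩)
      (by rw [← map_pow, ← map_mul]; exact congrArg hK.ringEquiv (by decide))
      (not_mem_of_eq_mul_add_intCast (ℓ := 2) (by norm_num) hℓ₀ hπ₀ (z := hK.ringEquiv ⟨-174002, -290785⟩) (d := 1)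
        (by rw [← map_mul, ← hK.ringEquiv_intCast, ← map_add]; exact congrArg hK.ringEquiv (by decide)) (by norm_num))]
    norm_num
  have c31 : WithZero.log (v₁.valuation K ((hK.ringEquiv ⟨-19056918528, 5701697536⟩ : 𝓞 K) : K)) = -2 := by
    rw [log_valuation_eq_neg_of_eq_pow_mul hv₁ 2 (y := hK.ringEquiv ⟨1086947328, 48234496⟩)
      (by rw [← map_pow, ← map_mul]; exact congrArg hK.ringEquiv (by decide))
      (not_mem_of_eq_mul_add_intCast (ℓ := 19) (by norm_num) hℓ₁ hπ₁ (z := hK.ringEquiv ⟨72439700, -169084604⟩) (d := 4)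
        (by rw [← map_mul, ← hK.ringEquiv_intCast, ← map_add]; exact congrArg hK.ringEquiv (by decide)) (by norm_num))]
    norm_num
  have c32 : WithZero.log (v₂.valuation K ((hK.ringEquiv ⟨-19056918528, 5701697536⟩ : 𝓞 K) : K)) = -3 := by
    rw [log_valuation_eq_neg_of_eq_pow_mul hv₂ 3 (y := hK.ringEquiv ⟨222068736, 80969728⟩)
      (by rw [← map_pow, ← map_mul]; exact congrArg hK.ringEquiv (by decide))
      (not_mem_of_eq_mul_add_intCast (ℓ := 19) (by norm_num) hℓ₂ hπ₂ (z := hK.ringEquiv ⟨-13881560, 39325048⟩) (d := 8)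
        (by rw [← map_mul, ← hK.ringEquiv_intCast, ← map_add]; exact congrArg hK.ringEquiv (by decide)) (by norm_num))]
    norm_num
  have c33 : WithZero.log (v₃.valuation K ((hK.ringEquiv ⟨-19056918528, 5701697536⟩ : 𝓞 K) : K)) = -0 := by
    rw [log_valuation_eq_neg_of_eq_pow_mul hv₃ 0 (y := hK.ringEquiv ⟨-19056918528, 5701697536⟩)
      (by rw [pow_zero, one_mul])
      (by
        rw [hv₃, mem_span_singleton, e37, map_dvd_iff hK.ringEquiv, ← Zsqrtd.intCast_val, Zsqrtd.intCast_dvd]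
        norm_num)]
    norm_num
  intro i j
  fin_cases i <;> fin_cases j
  · simpa using c00
  · simpa using c01
  · simpa using c02
  · simpa using c03
  · simpa using c10
  · simpa using c11
  · simpa using c12
  · simpa using c13
  · simpa using c20
  · simpa using c21
  · simpa using c22
  · simpa using c23
  · simpa using c30
  · simpa using c31
  · simpa using c32
  · simpa using c33

/-- **The orders of the base value `f_T(2T) = −1170286912 = −2⁶·19²·37³` at the four places**: `[12, 2, 2, 3]`.
[cite: SilvermanAEC2009, Exercise 10.1(c)] -/
theorem log_valuation_base : ∀ j : Fin 4,
    WithZero.log ((![v₀, v₁, v₂, v₃] j).valuation K (((hK.ringEquiv ⟨-1170286912, 0⟩ : 𝓞 K) : 𝓞 K) : K)) =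
      -((![12, 2, 2, 3] : Fin 4 → ℕ) j : ℤ) := by
  obtain ⟨hℓ₀, hℓ₁, hℓ₂, hℓ₃⟩ := natCast_mem_places hK hv₀ hv₁ hv₂ hv₃
  have hπ₀ : hK.ringEquiv ⟨0, 1⟩ ∈ v₀.asIdeal := by rw [hv₀]; exact mem_span_singleton_self _
  have hπ₁ : hK.ringEquiv ⟨1, 3⟩ ∈ v₁.asIdeal := by rw [hv₁]; exact mem_span_singleton_self _
  have hπ₂ : hK.ringEquiv ⟨1, -3⟩ ∈ v₂.asIdeal := by rw [hv₂]; exact mem_span_singleton_self _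
  have e37 : ((37 : ℕ) : 𝓞 K) = hK.ringEquiv ⟨37, 0⟩ := by
    rw [show ((37 : ℕ) : 𝓞 K) = ((37 : ℤ) : 𝓞 K) by norm_cast, ← hK.ringEquiv_intCast, Zsqrtd.intCast_val]

  have b00 : WithZero.log (v₀.valuation K ((hK.ringEquiv ⟨-1170286912, 0⟩ : 𝓞 K) : K)) = -12 := by
    rw [log_valuation_eq_neg_of_eq_pow_mul hv₀ 12 (y := hK.ringEquiv ⟨-18285733, 0⟩)
      (by rw [← map_pow, ← map_mul]; exact congrArg hK.ringEquiv (by decide))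
      (not_mem_of_eq_mul_add_intCast (ℓ := 2) (by norm_num) hℓ₀ hπ₀ (z := hK.ringEquiv ⟨0, 9142867⟩) (d := 1)
        (by rw [← map_mul, ← hK.ringEquiv_intCast, ← map_add]; exact congrArg hK.ringEquiv (by decide)) (by norm_num))]
    norm_num
  have b01 : WithZero.log (v₁.valuation K ((hK.ringEquiv ⟨-1170286912, 0⟩ : 𝓞 K) : K)) = -2 := by
    rw [log_valuation_eq_neg_of_eq_pow_mul hv₁ 2 (y := hK.ringEquiv ⟨55110464, 19450752⟩)
      (by rw [← map_pow, ← map_mul]; exact congrArg hK.ringEquiv (by decide))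
      (not_mem_of_eq_mul_add_intCast (ℓ := 19) (by norm_num) hℓ₁ hπ₁ (z := hK.ringEquiv ⟨9042893, -7677927⟩) (d := 9)
        (by rw [← map_mul, ← hK.ringEquiv_intCast, ← map_add]; exact congrArg hK.ringEquiv (by decide)) (by norm_num))]
    norm_num
  have b02 : WithZero.log (v₂.valuation K ((hK.ringEquiv ⟨-1170286912, 0⟩ : 𝓞 K) : K)) = -2 := by
    rw [log_valuation_eq_neg_of_eq_pow_mul hv₂ 2 (y := hK.ringEquiv ⟨55110464, -19450752⟩)
      (by rw [← map_pow, ← map_mul]; exact congrArg hK.ringEquiv (by decide))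
      (not_mem_of_eq_mul_add_intCast (ℓ := 19) (by norm_num) hℓ₂ hπ₂ (z := hK.ringEquiv ⟨9042893, 7677927⟩) (d := 9)
        (by rw [← map_mul, ← hK.ringEquiv_intCast, ← map_add]; exact congrArg hK.ringEquiv (by decide)) (by norm_num))]
    norm_num
  have b03 : WithZero.log (v₃.valuation K ((hK.ringEquiv ⟨-1170286912, 0⟩ : 𝓞 K) : K)) = -3 := by
    rw [log_valuation_eq_neg_of_eq_pow_mul hv₃ 3 (y := hK.ringEquiv ⟨-23104, 0⟩)
      (by rw [e37, ← map_pow, ← map_mul]; exact congrArg hK.ringEquiv (by decide))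
      (by
        rw [hv₃, mem_span_singleton, e37, map_dvd_iff hK.ringEquiv, ← Zsqrtd.intCast_val, Zsqrtd.intCast_dvd]
        norm_num)]
    norm_num
  intro j
  fin_cases j
  · simpa using b00
  · simpa using b01
  · simpa using b02
  · simpa using b03

end Table

end KubertTateM37152SqrtNegTwoDescent

end Literature.NumberTheory.EllipticCurves

end
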